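import Literature.Computability.AlgebraicComplexity.MoreAsymmetricEpsilon
import Literature.Computability.AlgebraicComplexity.GlobalStageThreeRegions
import HarnessLib

/-!
# ADVXXZ Theorem 5.3, six regions: the more asymmetric global stage
(Alman–Duan–Vassilevska Williams–Xu–Xu–Zhou 2025, Prop. 5.1 / Thm. 5.3 with §5.1 "Dividing into
Regions" and §5.6 "Summary") — proved, explicit errors

Topic `Literature/Computability/AlgebraicComplexity`.  §5.1 of Alman–Duan–Vassilevska Williams–Xu–Xu–
Zhou (SODA 2025, arXiv:2404.16349): "Since our method is more asymmetric, we need to partition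
`(CW_q^{⊗2^{ℓ−1}})^{⊗n}` into six regions instead … `≡ ⊗_{r=1}^{6} (CW_q^{⊗2^{ℓ−1}})^{⊗A_r n}`"; §5.6: "In
region `r ∈ [6]`, let `π_r` be the `r`-th permutation [of `{X,Y,Z}`] in the lexicographic order and we
perform the same procedure with `π_r(X)`-blocks in place of `X`-blocks, … In the end, we take the tensor
product over the output tensor of the algorithm over all 6 regions."  With the one-region theorem
`advxxz2025_thm53_region` (`MoreAsymmetricEpsilon.lean`, identity permutation) this file PROVES the
six-region statement at fixed region sizes `n₁, …, n₆` (`= A_r n`), exactly as `GlobalStageThreeRegions.lean`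
proves VXXZ's three-region Thm. 5.3:

* `MoreAsymRegionDatum` — the data of one region in the identity orientation (a `RegionDatum` with, in
  addition, `0 ≤ β_Y ≤ 1`), its exponent
  `E = min{H(Q_X/n) − P, H(β̄_Y) − η_Y, H(β̄_Z) − λ_Z, H(Q/n)}` and `advxxz2025_thm53_regionDatum`;
* `tensorRestrictsTo_inputCopies_swapXY` — the `X ↔ Y` symmetry with input multiplicities (the `Y ↔ Z`
  and `X ↔ Z` ones are in `GlobalStageThreeRegions.lean`); composing, a degeneration
  `⟨N⟩ ⊗ (CW_q^{⊗c})^{⊗n} ≥ ⟨κ⟩ ⊗ 𝒯_{τ,L,ε}` yields the same for each of the six slot-renamings of the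
  parameter list `L` (`id`, `YZ`, `XY`, `XY∘YZ`, `YZ∘XY`, `XZ` — the six permutations `π_r`), so a datum
  written in the identity orientation serves every region;
* `advxxz2025_thm53` — **Thm. 5.3**: for six data `D₁, …, D₆`,
  `⟨N₁⋯N₆⟩ ⊗ (CW_q^{⊗c})^{⊗(n₁+⋯+n₆)} ≥ ⟨κ₁⋯κ₆⟩ ⊗ 𝒯_{τ₁⧺⋯⧺τ₆, L₁ ⧺ L₂^{YZ} ⧺ L₃^{XY} ⧺ L₄^{XY∘YZ} ⧺ L₅^{YZ∘XY} ⧺ L₆^{XZ}, ε}`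
  with `N_r = ((n_r+1)^{3^c|S₃|})^3 = 2^{o(n)}` and `log₂(κ_r+1) ≥ n_r (E_r − epsLoss₂(ε)) − thm53Err(n_r)` —
  the printed `2^{(∑_{r=1}^{6} A_r E_r − o_{1/ε}(1))n − o(n)}` copies of the level-`ℓ` `ε`-interface tensor
  with parameter list `{(n A_r α^{(r)}(i,j,k), i, j, k, β^{(r)}_X, β^{(r)}_Y, β^{(r)}_Z)}_{r ∈ [6], i+j+k=2^ℓ}`.

Everything is proved; the definitions are `MoreAsymRegionDatum` and its projections; no named facts.

## References

* J. Alman, R. Duan, V. Vassilevska Williams, Y. Xu, Z. Xu, R. Zhou, *More asymmetry yields faster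
  matrix multiplication*, SODA 2025, arXiv:2404.16349 (held: `paper:arxiv-2404.16349`, chunks p0015,
  p0020): Prop. 5.1, Thm. 5.3, §5.1, §5.6. [AlmanDuanVassilevskaWilliamsXuXuZhou2025]
* V. Vassilevska Williams, Y. Xu, Z. Xu, R. Zhou, *New bounds for matrix multiplication: from alpha
  to omega*, SODA 2024, arXiv:2307.07970, §5.1 and §5.7 (three regions). [VassilevskaWilliamsXuXuZhou2024]
-/

noncomputable section

open scoped BigOperators
open Finset

namespace Literature.Computability.AlgebraicComplexity

open Literature.Barriers.MatrixMultiplication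

universe u

/-! ## The `X ↔ Y` symmetry with input multiplicities -/

section InputCopiesXY

variable (K : Type u) [CommSemiring K] (q : ℕ) {c n s : ℕ}

/-- `⟨N⟩ ⊗ (CW_q^{⊗c})^{⊗n}` is symmetric under swapping the first two slots. [folklore] -/
theorem inputCopies_swap₁₂ (N : ℕ) (u v w : Fin N × (Fin n → Fin c → Fin (q + 2))) :
    kroneckerTensor (unitTensor K N) (kroneckerPow (kroneckerPow (bigCwTensor K q) c) n) v u w =
      kroneckerTensor (unitTensor K N) (kroneckerPow (kroneckerPow (bigCwTensor K q) c) n) u v w := by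
  simp only [kroneckerTensor_apply]
  rw [(unitTensor_perm K N u.1 v.1 w.1).2.1, kroneckerPow_bigCw_swap₁₂]

/-- **The `X ↔ Y` symmetry with input multiplicities** (§5.6: "we perform the same procedure with
`π_r(X)`-blocks in place of `X`-blocks …"): from `⟨N⟩ ⊗ (CW_q^{⊗c})^{⊗n} ≥ ⟨κ⟩ ⊗ 𝒯_{τ,L,ε}` one gets
`⟨N⟩ ⊗ (CW_q^{⊗c})^{⊗n} ≥ ⟨κ⟩ ⊗ 𝒯_{τ,L^{XY},ε}`. [cite: AlmanDuanVassilevskaWilliamsXuXuZhou2025, §5.6 (the six permutations π_r)] -/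
theorem tensorRestrictsTo_inputCopies_swapXY (N : ℕ) (τ : Fin n → Fin s) (L : Fin s → InterfaceTerm c) (ε : ℝ) (κ : ℕ)
    (h : TensorRestrictsTo (kroneckerTensor (unitTensor K N) (kroneckerPow (kroneckerPow (bigCwTensor K q) c) n))
      (kroneckerTensor (unitTensor K κ) (interfaceTensor K q τ L ε))) :
    TensorRestrictsTo (kroneckerTensor (unitTensor K N) (kroneckerPow (kroneckerPow (bigCwTensor K q) c) n))
      (kroneckerTensor (unitTensor K κ) (interfaceTensor K q τ (fun t => (L t).swapXY) ε)) := by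
  have h' := h.swap₁₂
  have e1 : (fun v u w => kroneckerTensor (unitTensor K N) (kroneckerPow (kroneckerPow (bigCwTensor K q) c) n) u v w) =
      kroneckerTensor (unitTensor K N) (kroneckerPow (kroneckerPow (bigCwTensor K q) c) n) := by
    funext v u w; exact inputCopies_swap₁₂ K q N v u w
  have e2 : (fun v u w => kroneckerTensor (unitTensor K κ) (interfaceTensor K q τ L ε) u v w) =
      kroneckerTensor (unitTensor K κ) (interfaceTensor K q τ (fun t => (L t).swapXY) ε) := by
    funext v u w
    simp only [kroneckerTensor_apply]
    rw [← (unitTensor_perm K κ v.1 u.1 w.1).2.1, interfaceTensor_swapXY]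
  rw [e1, e2] at h'
  exact h'

end InputCopiesXY

/-! ## The datum of one region (identity orientation) -/

/-- **The datum of one region of the more asymmetric global stage, in the identity orientation**
(`X`-blocks unique after hashing, then `Y`-, then `Z`-compatibility): a `RegionDatum` (joint type `Q`,
a triple `T₀` of type `Q`, target split distributions with `0 ≤ β_Z ≤ 1`) with, in addition, `0 ≤ β_Y ≤ 1`.
For region `r` one supplies the data of the `π_r`-renamed dimensions. [cite: AlmanDuanVassilevskaWilliamsXuXuZhou2025, Prop. 5.1 (the data α^{(r)}, β^{(r)}_{W,i,j,k})] -/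
structure MoreAsymRegionDatum (c n : ℕ) extends RegionDatum c n where
  /-- `β_Y ≥ 0` -/
  γY_nonneg : ∀ ijk σ, 0 ≤ γY ijk σ
  /-- `β_Y ≤ 1` -/
  γY_le_one : ∀ ijk σ, γY ijk σ ≤ 1

namespace MoreAsymRegionDatum

variable {c n : ℕ} (D : MoreAsymRegionDatum c n)

/-- **The exponent `E` of the datum** at the type: `min{H(Q_X/n) − P, H(β̄_Y) − η_Y, H(β̄_Z) − λ_Z, H(Q/n)}`,
`P = maxEnt(Q/n) − H(Q/n)`. [cite: AlmanDuanVassilevskaWilliamsXuXuZhou2025, Prop. 5.1 (E_r)] -/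
def exponent : ℝ :=
  min (min (shannonEntropy (fun i => ((∑ j, ∑ l, D.Q (i, j, l) : ℕ) : ℝ) / n) -
          (maxEntropyGivenMarginals (levelSupport (2 * c)) (fun s => (D.Q s : ℝ) / n) - shannonEntropy (fun s => (D.Q s : ℝ) / n)))
        (shannonEntropy (targetPairDistY (isLevelTriple_of_mem_jointTypeClass D.Q_supp D.T₀_mem) D.γY) -
          targetEta (isLevelTriple_of_mem_jointTypeClass D.Q_supp D.T₀_mem) (typeAlpha n D.Q) D.γY))
    (min (shannonEntropy (targetPairDist (isLevelTriple_of_mem_jointTypeClass D.Q_supp D.T₀_mem) D.γZ) -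
          targetLambda (isLevelTriple_of_mem_jointTypeClass D.Q_supp D.T₀_mem) (typeAlpha n D.Q) D.γZ)
      (shannonEntropy (fun s => (D.Q s : ℝ) / n)))

end MoreAsymRegionDatum

/-! ## Theorem 5.3 (six regions) -/

section Thm53

variable (K : Type u) [CommSemiring K] (q : ℕ) {c : ℕ}

/-- **Thm. 5.3 (more asymmetric), one region, for a datum** (`advxxz2025_thm53_region` restated).
[cite: AlmanDuanVassilevskaWilliamsXuXuZhou2025, Thm. 5.3] -/
theorem advxxz2025_thm53_regionDatum (hc : 0 < c) {n : ℕ} (hn : 0 < n) (D : MoreAsymRegionDatum c n) {ε : ℝ}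
    (hε0 : 0 ≤ ε) (hε1 : ε ≤ 1) :
    ∃ κ : ℕ,
      TensorRestrictsTo (kroneckerTensor (unitTensor K (inputCopies c n)) (kroneckerPow (kroneckerPow (bigCwTensor K q) c) n))
        (kroneckerTensor (unitTensor K κ) (interfaceTensor K q D.termMap D.termList ε)) ∧
      (n : ℝ) * (D.exponent - epsLoss₂ c ε) - thm53Err c n ≤ Real.logb 2 ((κ : ℝ) + 1) :=
  advxxz2025_thm53_region K q hc hn D.sum_Q D.Q_supp D.T₀_mem D.γX D.γY D.γZ D.γY_nonneg D.γY_le_one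
    D.γZ_nonneg D.γZ_le_one hε0 hε1

/-- **Alman–Duan–Vassilevska Williams–Xu–Xu–Zhou, Theorem 5.3 (the global stage), at fixed region sizes and
with explicit errors.**  For six region data `D₁, …, D₆` (sizes `n₁, …, n₆ ≥ 1`, i.e. `A_r n`; each written in
the identity orientation) and `0 ≤ ε ≤ 1`:
`⟨N₁⋯N₆⟩ ⊗ (CW_q^{⊗c})^{⊗(n₁+⋯+n₆)} ≥ ⟨κ₁⋯κ₆⟩ ⊗ 𝒯_{τ₁⧺⋯⧺τ₆, L₁ ⧺ L₂^{YZ} ⧺ L₃^{XY} ⧺ L₄^{XY∘YZ} ⧺ L₅^{YZ∘XY} ⧺ L₆^{XZ}, ε}`,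
`N_r = ((n_r+1)^{3^c|S₃|})^3`, `log₂(κ_r+1) ≥ n_r (E_r − epsLoss₂ c ε) − thm53Err c n_r` — i.e. `2^{o(n)}`
independent copies of the input degenerate into `2^{(∑_r A_r E_r − o_{1/ε}(1)) n − o(n)}` independent
copies of the level-`ℓ` `ε`-interface tensor whose parameter list is the concatenation over the six regions
(region `r` in the orientation `π_r`, the six slot-renamings `id, YZ, XY, XY∘YZ, YZ∘XY, XZ`).
[cite: AlmanDuanVassilevskaWilliamsXuXuZhou2025, Thm. 5.3, Prop. 5.1 and §5.6] -/
theorem advxxz2025_thm53 (hc : 0 < c) {n₁ n₂ n₃ n₄ n₅ n₆ : ℕ} (hn₁ : 0 < n₁) (hn₂ : 0 < n₂) (hn₃ : 0 < n₃)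
    (hn₄ : 0 < n₄) (hn₅ : 0 < n₅) (hn₆ : 0 < n₆)
    (D₁ : MoreAsymRegionDatum c n₁) (D₂ : MoreAsymRegionDatum c n₂) (D₃ : MoreAsymRegionDatum c n₃)
    (D₄ : MoreAsymRegionDatum c n₄) (D₅ : MoreAsymRegionDatum c n₅) (D₆ : MoreAsymRegionDatum c n₆)
    {ε : ℝ} (hε0 : 0 ≤ ε) (hε1 : ε ≤ 1) :
    ∃ κ₁ κ₂ κ₃ κ₄ κ₅ κ₆ : ℕ,
      TensorRestrictsTo
        (kroneckerTensor (unitTensor K (inputCopies c n₁ * inputCopies c n₂ * inputCopies c n₃ * inputCopies c n₄ *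
            inputCopies c n₅ * inputCopies c n₆))
          (kroneckerPow (kroneckerPow (bigCwTensor K q) c) (n₁ + n₂ + n₃ + n₄ + n₅ + n₆)))
        (kroneckerTensor (unitTensor K (κ₁ * κ₂ * κ₃ * κ₄ * κ₅ * κ₆))
          (interfaceTensor K q
            (concatTermMap (concatTermMap (concatTermMap (concatTermMap (concatTermMap D₁.termMap D₂.termMap) D₃.termMap)
              D₄.termMap) D₅.termMap) D₆.termMap)
            (Fin.append (Fin.append (Fin.append (Fin.append (Fin.append D₁.termList (fun t => (D₂.termList t).swapYZ))
              (fun t => (D₃.termList t).swapXY)) (fun t => ((D₄.termList t).swapYZ).swapXY))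
              (fun t => ((D₅.termList t).swapXY).swapYZ)) (fun t => (D₆.termList t).swapXZ)) ε)) ∧
      (n₁ : ℝ) * (D₁.exponent - epsLoss₂ c ε) - thm53Err c n₁ ≤ Real.logb 2 ((κ₁ : ℝ) + 1) ∧
      (n₂ : ℝ) * (D₂.exponent - epsLoss₂ c ε) - thm53Err c n₂ ≤ Real.logb 2 ((κ₂ : ℝ) + 1) ∧
      (n₃ : ℝ) * (D₃.exponent - epsLoss₂ c ε) - thm53Err c n₃ ≤ Real.logb 2 ((κ₃ : ℝ) + 1) ∧
      (n₄ : ℝ) * (D₄.exponent - epsLoss₂ c ε) - thm53Err c n₄ ≤ Real.logb 2 ((κ₄ : ℝ) + 1) ∧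
      (n₅ : ℝ) * (D₅.exponent - epsLoss₂ c ε) - thm53Err c n₅ ≤ Real.logb 2 ((κ₅ : ℝ) + 1) ∧
      (n₆ : ℝ) * (D₆.exponent - epsLoss₂ c ε) - thm53Err c n₆ ≤ Real.logb 2 ((κ₆ : ℝ) + 1) := by
  obtain ⟨κ₁, h₁, b₁⟩ := advxxz2025_thm53_regionDatum K q hc hn₁ D₁ hε0 hε1
  obtain ⟨κ₂, h₂, b₂⟩ := advxxz2025_thm53_regionDatum K q hc hn₂ D₂ hε0 hε1
  obtain ⟨κ₃, h₃, b₃⟩ := advxxz2025_thm53_regionDatum K q hc hn₃ D₃ hε0 hε1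
  obtain ⟨κ₄, h₄, b₄⟩ := advxxz2025_thm53_regionDatum K q hc hn₄ D₄ hε0 hε1
  obtain ⟨κ₅, h₅, b₅⟩ := advxxz2025_thm53_regionDatum K q hc hn₅ D₅ hε0 hε1
  obtain ⟨κ₆, h₆, b₆⟩ := advxxz2025_thm53_regionDatum K q hc hn₆ D₆ hε0 hε1
  refine ⟨κ₁, κ₂, κ₃, κ₄, κ₅, κ₆, ?_, b₁, b₂, b₃, b₄, b₅, b₆⟩
  -- the five renamings
  have h₂' := tensorRestrictsTo_inputCopies_swapYZ K q _ D₂.termMap D₂.termList ε κ₂ h₂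
  have h₃' := tensorRestrictsTo_inputCopies_swapXY K q _ D₃.termMap D₃.termList ε κ₃ h₃
  have h₄' := tensorRestrictsTo_inputCopies_swapXY K q _ D₄.termMap (fun t => (D₄.termList t).swapYZ) ε κ₄
    (tensorRestrictsTo_inputCopies_swapYZ K q _ D₄.termMap D₄.termList ε κ₄ h₄)
  have h₅' := tensorRestrictsTo_inputCopies_swapYZ K q _ D₅.termMap (fun t => (D₅.termList t).swapXY) ε κ₅
    (tensorRestrictsTo_inputCopies_swapXY K q _ D₅.termMap D₅.termList ε κ₅ h₅)
  have h₆' := tensorRestrictsTo_inputCopies_swapXZ K q _ D₆.termMap D₆.termList ε κ₆ h₆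
  -- the products
  have h₁₂ := tensorRestrictsTo_inputCopies_mul K q D₁.termMap D₁.termList D₂.termMap (fun t => (D₂.termList t).swapYZ) ε h₁ h₂'
  have h₁₃ := tensorRestrictsTo_inputCopies_mul K q _ _ D₃.termMap (fun t => (D₃.termList t).swapXY) ε h₁₂ h₃'
  have h₁₄ := tensorRestrictsTo_inputCopies_mul K q _ _ D₄.termMap (fun t => ((D₄.termList t).swapYZ).swapXY) ε h₁₃ h₄'
  have h₁₅ := tensorRestrictsTo_inputCopies_mul K q _ _ D₅.termMap (fun t => ((D₅.termList t).swapXY).swapYZ) ε h₁₄ h₅'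
  exact tensorRestrictsTo_inputCopies_mul K q _ _ D₆.termMap (fun t => (D₆.termList t).swapXZ) ε h₁₅ h₆'

end Thm53

end Literature.Computability.AlgebraicComplexity
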